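import Summits.Parity.GeneralizedHardyLittlewood.Theorems.GreenTaoLevelTwoGITwoCyclicInverseBracketFactorised
import Summits.Parity.GeneralizedHardyLittlewood.Theorems.GreenTaoLevelTwoGITwoCyclicInverseRealisationOn
import Summits.Parity.GeneralizedHardyLittlewood.Theorems.GreenTaoLevelTwoGITwoCyclicInverseBohrSizeRho

/-!
# Route `GreenTaoLevelTwo`, crux `GITwo` (stmt-Parity-21275), line `birth`, stub `stub_cyclicInverse`:
# from one local quadratic correlation datum to a real nilsequence correlation (GT08a arXiv Thm. 68)

Helper toward the XL stub `stub_cyclicInverse` (B. Green, T. Tao, *An inverse theorem for the Gowers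
`U³(G)` norm*, arXiv:math/0503014, Thm. 68 = PEMS 51 (2008) Thm. 12.8).  Block E17, fourth plumbing
step: for ONE datum of `local_quadratic_correlation_uniform` (frequency set `S' ∋ 1`, `μ` additive on
`B(S',ρ₄)`, regular `B(S',ρ₅)`, correlation parameter `k`) and the product nilmanifold `Z` fixed in
advance for `#S'` frequencies, the chain `exists_tiny_regular_bohr` → `exists_factorised_bracket_correlation`
→ `exists_real_correlation_of_bracket` → `card_bohr_ge_rho` yields `g, x₀, h` and a real `1`-bounded `F`
on `Z` with Lipschitz constant and correlation controlled by `k`, `ρ₅`, `#S'`, `L` and the radius `ρ₆` of the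
tiny Bohr set (itself bounded below in terms of `k, ρ₅, #S'`).  Def-free:

* `exists_enumeration` — enumerating `S'` by `Fin #S'`;
* `exists_correlation_of_datum` — the statement described above.

References: [GreenTao2008U3Inverse] arXiv:math/0503014, §§10–12, proof of Thm. 68.
-/

noncomputable section

namespace Summit.Parity.GeneralizedHardyLittlewood.GreenTaoLevelTwoGITwoCyclicInverse

open Finset ZMod
open Literature.NumberTheory.Sieve
open Literature.NumberTheory.Sieve.GreenTaoLevelTwo

/-- An enumeration of a finset of `ℤ/Nℤ` by `Fin #S'` hitting a prescribed element. [folklore] -/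
theorem exists_enumeration {N : ℕ} (S' : Finset (ZMod N)) {s₀ : ZMod N} (hs₀ : s₀ ∈ S') :
    ∃ (ξ : Fin #S' → ZMod N) (l₀ : Fin #S'), (∀ s, s ∈ S' ↔ ∃ l, ξ l = s) ∧ ξ l₀ = s₀ := by
  classical
  refine ⟨fun l => ((S'.equivFin.symm l : S') : ZMod N), S'.equivFin ⟨s₀, hs₀⟩, fun s => ?_, ?_⟩
  · constructor
    · intro hs
      exact ⟨S'.equivFin ⟨s, hs⟩, by simp⟩
    · rintro ⟨l, rfl⟩
      exact (S'.equivFin.symm l).2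
  · simp

/-- **One datum of the local quadratic correlation gives a real nilsequence correlation on the product
nilmanifold fixed in advance (arXiv §§10–12, proof of Thm. 68).**  See the module docstring; the output
records the radius `ρ₆` of the tiny Bohr set with its lower bound `kρ₅/(12800 d³ 2^{d(d+2)})` (`d = #S'`),
the Lipschitz constant `2π + d((L_κ+2π+2/(½−r₂))+2π) + d·d·(2(L_κ+2π+2/(½−r₂)) + 2(4π+L_κ+2/(½−r₂))L)` with
`L_κ = 6400 d/(kρ₆)`, `r₂ ≤ 1/4`, and the correlation `≥ (k/128)(ρ₆/2)^d`.
[cite: GreenTao2008U3Inverse, §§10–12, proof of Thm. 68] -/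
theorem exists_correlation_of_datum (dH : HX → HX → ℝ) (h : IsCompatMetric dH) {L : ℝ}
    (hL : 0 ≤ L) (hcomp : ∀ p q, heisPreDist p q ≤ L * dH p q ∧ dH p q ≤ L * heisPreDist p q)
    {N : ℕ} [NeZero N] (hN : N.Prime) (h2 : 2 < N) (f : ZMod N → ℝ) (hf : ∀ x, |f x| ≤ 1)
    {k : ℝ} (S' : Finset (ZMod N)) (c : ZMod N) (μ : ZMod N → ZMod N) {ρ₄ ρ₅ : ℝ} (x₀ t ζ : ZMod N)
    (hk0 : 0 < k) (hk1 : k ≤ 1) (h1S' : (1 : ZMod N) ∈ S') (hρ₅0 : 0 < ρ₅)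
    (hρ₅4 : ρ₅ ≤ ρ₄ / (100 * (#S' : ℝ))) (hρ₄8 : ρ₄ ≤ 1 / 8)
    (hreg₅ : ∀ r : ℝ, |r| ≤ 1 / (100 * (#S' : ℝ)) →
      (1 - 100 * (#S' : ℝ) * |r|) * #{x : ZMod N | ∀ ξ ∈ S', ‖ZMod.toAddCircle (x * ξ)‖ < ρ₅} ≤
          #{x : ZMod N | ∀ ξ ∈ S', ‖ZMod.toAddCircle (x * ξ)‖ < (1 + r) * ρ₅} ∧
        (#{x : ZMod N | ∀ ξ ∈ S', ‖ZMod.toAddCircle (x * ξ)‖ < (1 + r) * ρ₅} : ℝ) ≤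
          (1 + 100 * (#S' : ℝ) * |r|) * #{x : ZMod N | ∀ ξ ∈ S', ‖ZMod.toAddCircle (x * ξ)‖ < ρ₅})
    (hadd : ∀ x ∈ ({v : ZMod N | ∀ ξ ∈ S', ‖ZMod.toAddCircle (v * ξ)‖ < ρ₄} : Finset (ZMod N)),
      ∀ h ∈ ({v : ZMod N | ∀ ξ ∈ S', ‖ZMod.toAddCircle (v * ξ)‖ < ρ₄} : Finset (ZMod N)),
        μ (x + h) = μ x + μ h)
    (hx₀ : x₀ ∈ ({v : ZMod N | ∀ ξ ∈ S', ‖ZMod.toAddCircle (v * ξ)‖ < ρ₄} : Finset (ZMod N)))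
    (hbig : k / 16 * #{x : ZMod N | ∀ ξ ∈ S', ‖ZMod.toAddCircle (x * ξ)‖ < ρ₅} ≤
      ‖∑ w ∈ ({x : ZMod N | ∀ ξ ∈ S', ‖ZMod.toAddCircle (x * ξ)‖ < ρ₅} : Finset (ZMod N)),
        ((f (w + t) : ℝ) : ℂ) * stdAddChar (c * μ (x₀ + w) * (x₀ + w)) * stdAddChar (w * ζ)‖)
    (Z : Nilmanifold 2)
    (huniv :
      ∀ (Φ : ∀ i : Unit ⊕ (Fin #S' ⊕ (Fin #S' × Fin #S')),
          (Sum.elim (fun _ => Nilmanifold.circle.ofLE (by norm_num : 1 ≤ 2))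
            (Sum.elim
              (fun _ => (Nilmanifold.circle.ofLE (by norm_num : 1 ≤ 2)).prod
                (Nilmanifold.circle.ofLE (by norm_num : 1 ≤ 2)))
              (fun _ => ((Nilmanifold.circle.ofLE (by norm_num : 1 ≤ 2)).prod
                (Nilmanifold.circle.ofLE (by norm_num : 1 ≤ 2))).prod
                  ((heisenbergWith dH h).prod (heisenbergWith dH h)))) i).G ⧸
          (Sum.elim (fun _ => Nilmanifold.circle.ofLE (by norm_num : 1 ≤ 2))
            (Sum.elim
              (fun _ => (Nilmanifold.circle.ofLE (by norm_num : 1 ≤ 2)).prod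
                (Nilmanifold.circle.ofLE (by norm_num : 1 ≤ 2)))
              (fun _ => ((Nilmanifold.circle.ofLE (by norm_num : 1 ≤ 2)).prod
                (Nilmanifold.circle.ofLE (by norm_num : 1 ≤ 2))).prod
                  ((heisenbergWith dH h).prod (heisenbergWith dH h)))) i).Γ → ℂ)
        (g : ∀ i, (Sum.elim (fun _ => Nilmanifold.circle.ofLE (by norm_num : 1 ≤ 2))
            (Sum.elim
              (fun _ => (Nilmanifold.circle.ofLE (by norm_num : 1 ≤ 2)).prod
                (Nilmanifold.circle.ofLE (by norm_num : 1 ≤ 2)))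
              (fun _ => ((Nilmanifold.circle.ofLE (by norm_num : 1 ≤ 2)).prod
                (Nilmanifold.circle.ofLE (by norm_num : 1 ≤ 2))).prod
                  ((heisenbergWith dH h).prod (heisenbergWith dH h)))) i).G)
        (p : ∀ i, (Sum.elim (fun _ => Nilmanifold.circle.ofLE (by norm_num : 1 ≤ 2))
            (Sum.elim
              (fun _ => (Nilmanifold.circle.ofLE (by norm_num : 1 ≤ 2)).prod
                (Nilmanifold.circle.ofLE (by norm_num : 1 ≤ 2)))
              (fun _ => ((Nilmanifold.circle.ofLE (by norm_num : 1 ≤ 2)).prod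
                (Nilmanifold.circle.ofLE (by norm_num : 1 ≤ 2))).prod
                  ((heisenbergWith dH h).prod (heisenbergWith dH h)))) i).G ⧸
          (Sum.elim (fun _ => Nilmanifold.circle.ofLE (by norm_num : 1 ≤ 2))
            (Sum.elim
              (fun _ => (Nilmanifold.circle.ofLE (by norm_num : 1 ≤ 2)).prod
                (Nilmanifold.circle.ofLE (by norm_num : 1 ≤ 2)))
              (fun _ => ((Nilmanifold.circle.ofLE (by norm_num : 1 ≤ 2)).prod
                (Nilmanifold.circle.ofLE (by norm_num : 1 ≤ 2))).prod
                  ((heisenbergWith dH h).prod (heisenbergWith dH h)))) i).Γ)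
        (M : Unit ⊕ (Fin #S' ⊕ (Fin #S' × Fin #S')) → ℝ), (∀ i, 0 ≤ M i) → (∀ i y, ‖Φ i y‖ ≤ 1) →
        (∀ i y z, ‖Φ i y - Φ i z‖ ≤ M i *
          (Sum.elim (fun _ => Nilmanifold.circle.ofLE (by norm_num : 1 ≤ 2))
            (Sum.elim
              (fun _ => (Nilmanifold.circle.ofLE (by norm_num : 1 ≤ 2)).prod
                (Nilmanifold.circle.ofLE (by norm_num : 1 ≤ 2)))
              (fun _ => ((Nilmanifold.circle.ofLE (by norm_num : 1 ≤ 2)).prod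
                (Nilmanifold.circle.ofLE (by norm_num : 1 ≤ 2))).prod
                  ((heisenbergWith dH h).prod (heisenbergWith dH h)))) i).dist y z) →
        ∃ (Ψ : Z.G ⧸ Z.Γ → ℂ) (gZ : Z.G) (pZ : Z.G ⧸ Z.Γ),
          (∀ y, ‖Ψ y‖ ≤ 1) ∧ (∀ y z, ‖Ψ y - Ψ z‖ ≤ (∑ i, M i) * Z.dist y z) ∧
          ∀ n : ℤ, Ψ (gZ ^ n • pZ) = ∏ i, Φ i (g i ^ n • p i)) :
    ∃ (ρ₆ r₂ : ℝ) (g : Z.G) (p₀ : Z.G ⧸ Z.Γ) (t₁ : ZMod N) (F : Z.G ⧸ Z.Γ → ℝ),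
      k * ρ₅ / (12800 * (#S' : ℝ) * 2 ^ (#S' * (#S' + 2)) * (#S' : ℝ) ^ 2) ≤ ρ₆ ∧ 0 < ρ₆ ∧ ρ₆ ≤ 1 ∧
      r₂ ≤ 1 / 4 ∧
      Z.IsBoundedLipschitz (2 * Real.pi +
        #S' * ((6400 * (#S' : ℝ) / (k * ρ₆) + 2 * Real.pi + 2 / (1 / 2 - r₂)) + 2 * Real.pi) +
        #S' * #S' * (2 * (6400 * (#S' : ℝ) / (k * ρ₆) + 2 * Real.pi + 2 / (1 / 2 - r₂)) +
          2 * ((4 * Real.pi + 6400 * (#S' : ℝ) / (k * ρ₆) + 2 / (1 / 2 - r₂)) * L))) F ∧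
      k / 128 * (ρ₆ / 2) ^ #S' ≤
        |(∑ n ∈ Finset.Icc (-((N : ℤ) / 2)) ((N : ℤ) / 2), f ((n : ZMod N) + t₁) * F (g ^ n • p₀)) / N| := by
  classical
  have hNpos : (0 : ℝ) < N := by exact_mod_cast hN.pos
  have hodd : Odd N := hN.odd_of_ne_two (by omega)
  have hS'ne : S'.Nonempty := ⟨1, h1S'⟩
  have hd1 : (1 : ℝ) ≤ #S' := by exact_mod_cast Nat.one_le_iff_ne_zero.mpr (card_pos.mpr hS'ne).ne'
  have hd0 : (0 : ℝ) < #S' := by linarith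
  have hρ₄0 : 0 < ρ₄ := by
    have h1 : 0 < ρ₄ / (100 * (#S' : ℝ)) := hρ₅0.trans_le hρ₅4
    have h2 : (0 : ℝ) < 100 * #S' := by positivity
    have := mul_pos h1 h2
    rwa [div_mul_cancel₀ _ h2.ne'] at this
  have hρ₅ρ₄ : ρ₅ ≤ ρ₄ / 100 := by
    refine hρ₅4.trans ?_
    rw [div_le_div_iff₀ (by positivity) (by norm_num)]
    nlinarith
  -- Step 2: localisation to a tiny regular Bohr set
  obtain ⟨G₀, hG₀⟩ : ∃ G₀ : ZMod N → ℂ, G₀ = fun w => ((f (w + t) : ℝ) : ℂ) *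
      stdAddChar (c * μ (x₀ + w) * (x₀ + w)) * stdAddChar (w * ζ) := ⟨_, rfl⟩
  have hG₀1 : ∀ w, ‖G₀ w‖ ≤ 1 := fun w => by
    rw [hG₀]; simp only
    rw [norm_mul, norm_mul, norm_stdAddChar, norm_stdAddChar, mul_one, mul_one,
      Complex.norm_real, Real.norm_eq_abs]
    exact hf _
  have hbig' : k / 16 * #{x : ZMod N | ∀ ξ ∈ S', ‖ZMod.toAddCircle (x * ξ)‖ < ρ₅} ≤
      ‖∑ w ∈ ({x : ZMod N | ∀ ξ ∈ S', ‖ZMod.toAddCircle (x * ξ)‖ < ρ₅} : Finset (ZMod N)), G₀ w‖ := by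
    rw [hG₀]; exact hbig
  obtain ⟨ρ₆, y, hy, hρ₆0, hρ₆lo, hρ₆hi, hreg₆, hcorr₆⟩ :=
    exists_tiny_regular_bohr S' hS'ne hk0 hk1 hρ₅0 hreg₅ G₀ hG₀1 hbig'
  rw [hG₀] at hcorr₆
  simp only at hcorr₆
  have hpow1 : (1 : ℝ) ≤ 2 ^ (#S' * (#S' + 2)) := one_le_pow₀ (by norm_num)
  have hP0 : (0 : ℝ) < 2 ^ (#S' * (#S' + 2)) * (#S' : ℝ) * #S' := by positivity
  have hP1 : (1 : ℝ) ≤ 2 ^ (#S' * (#S' + 2)) * (#S' : ℝ) * #S' := by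
    calc (1 : ℝ) = 1 * 1 * 1 := by ring
      _ ≤ 2 ^ (#S' * (#S' + 2)) * (#S' : ℝ) * #S' :=
          mul_le_mul (mul_le_mul hpow1 hd1 zero_le_one (by positivity)) hd1 zero_le_one (by positivity)
  have hQ : 6400 * (#S' : ℝ) * 2 ^ (#S' * (#S' + 2)) * (#S' : ℝ) ^ 2 =
      (6400 * (#S' : ℝ)) * (2 ^ (#S' * (#S' + 2)) * (#S' : ℝ) * #S') := by ring
  have hkρ₅ : k * ρ₅ ≤ ρ₅ := mul_le_of_le_one_left hρ₅0.le hk1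
  have h6400 : (6400 : ℝ) ≤ 6400 * #S' := by nlinarith
  have hρ₆P : ρ₆ * (2 ^ (#S' * (#S' + 2)) * (#S' : ℝ) * #S') ≤ k * ρ₅ / (6400 * (#S' : ℝ)) := by
    have h1 := mul_le_mul_of_nonneg_right hρ₆hi hP0.le
    rw [hQ, div_mul_eq_mul_div, mul_div_mul_right _ _ hP0.ne'] at h1
    exact h1
  have hdiv : k * ρ₅ / (6400 * (#S' : ℝ)) ≤ ρ₅ / 6400 := by
    rw [div_le_div_iff₀ (by positivity) (by norm_num)]
    calc k * ρ₅ * 6400 ≤ ρ₅ * 6400 := mul_le_mul_of_nonneg_right hkρ₅ (by norm_num)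
      _ ≤ ρ₅ * (6400 * (#S' : ℝ)) := mul_le_mul_of_nonneg_left h6400 hρ₅0.le
  have hρ₆ρ₅ : ρ₆ ≤ ρ₅ / 6400 := by
    have h1 : ρ₆ ≤ ρ₆ * (2 ^ (#S' * (#S' + 2)) * (#S' : ℝ) * #S') :=
      le_mul_of_one_le_right hρ₆0.le hP1
    linarith
  have hρ₆8 : ρ₆ ≤ 1 / 8 := by linarith
  have hρ₆1 : ρ₆ ≤ 1 := by linarith
  have hρ : ρ₅ + 2 * ρ₆ ≤ ρ₄ := by linarith
  have hbr : 2 * ρ₆ * (2 ^ (#S' * (#S' + 2)) * (#S' : ℝ) * #S') < ρ₄ := by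
    have e : 2 * ρ₆ * (2 ^ (#S' * (#S' + 2)) * (#S' : ℝ) * #S') =
        2 * (ρ₆ * (2 ^ (#S' * (#S' + 2)) * (#S' : ℝ) * #S')) := by ring
    rw [e]
    linarith
  -- Step 3: enumeration of `S'` and the factorised bracket form
  obtain ⟨ξ, l₀, hS'ξ, hl₀⟩ := exists_enumeration S' h1S'
  obtain ⟨κ, r₂, A, B, ζ₁, t₁, hκ, hκ0, hr₂, hκL, hcorrF⟩ :=
    exists_factorised_bracket_correlation hN S' ξ hS'ξ l₀ hl₀ c μ hρ₄0 hadd hx₀ hy hρ₆0 hρ₆8 hρ hbr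
      hreg₆ hk0 hk1 f hf t ζ hcorr₆
  -- Step 4: realisation on `Z`
  have hLκ0 : 0 ≤ 6400 * (#S' : ℝ) / (k * ρ₆) := by positivity
  rw [← div_mul_cancel₀ (k / 64 * (#{x : ZMod N | ∀ ξ ∈ S', ‖ZMod.toAddCircle (x * ξ)‖ < ρ₆} : ℝ))
    hNpos.ne'] at hcorrF
  obtain ⟨g, p₀, F, hF, hcF⟩ := exists_real_correlation_of_bracket dH h hL hcomp (#S') Z huniv hodd ξ
    hκ hκ0 hr₂ hκL hLκ0 A B ζ₁ t₁ f hcorrF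
  refine ⟨ρ₆, r₂, g, p₀, t₁, F, hρ₆lo, hρ₆0, hρ₆1, hr₂, hF, le_trans ?_ hcF⟩
  -- the correlation is at least `(k/128)(ρ₆/2)^d`
  have hB₆ := card_bohr_ge_rho S' hρ₆0 hρ₆1
  calc k / 128 * (ρ₆ / 2) ^ #S' = k / 64 * ((ρ₆ / 2) ^ #S' * N) / N / 2 := by
        field_simp; norm_num
    _ ≤ k / 64 * #{x : ZMod N | ∀ ξ ∈ S', ‖ZMod.toAddCircle (x * ξ)‖ < ρ₆} / N / 2 := by gcongr

end Summit.Parity.GeneralizedHardyLittlewood.GreenTaoLevelTwoGITwoCyclicInverse
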